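import Literature.Analysis.FunctionSpaces.TorusConvectionGradNormSq
import Literature.Analysis.FunctionSpaces.TorusInverseLaplacianCalculus
import HarnessLib

/-!
# The `H²` norm of the inertial term `(u·∇)u` by the `H³` norm on `T³`

Analysis/FunctionSpaces support file (everything proved; no definitions, no named facts), sequel of
`TorusConvectionGradNormSq.lean` (`‖∇((u·∇)u)‖₂² ≤ C (‖∇u‖₂² + ‖Δu‖₂²) ‖Δu‖₂²`, the sup-norm embedding
`‖u(x)‖² ≤ K (‖∇u‖₂² + ‖Δu‖₂²)` for zero-mean fields). It proves the next rung of the ladder, the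
`L²` norm of the LAPLACIAN of the convective term — the torus form of "`B` maps `D(A^{3/2}) × D(A^{3/2})`
boundedly into `D(A)`", i.e. the `H²`-level instance of "`H^k(T³)` is an algebra for `k ≥ 2`" used in
the `k = 3` step of the regularity ladder of strong solutions (Robinson–Rodrigo–Sadowski 2016, proof of
Thm 7.1, estimate (7.3) with `k = 3`; Constantin–Foias 1988, Ch. 6 and Thm 10.6):

* `Torus.partialDeriv_convect_eq_add_convect` — the Leibniz rule `∂ₘ((v·∇)w) = (v·∇)∂ₘw + (∂ₘv·∇)w`
  for two smooth fields;
* `Torus.norm_partialDeriv_convect_le_add` — pointwise,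
  `‖∂ₖ((v·∇)w)‖ ≤ ‖v‖ ∑ⱼ ‖∂ⱼ∂ₖw‖ + ‖∂ₖv‖ ∑ⱼ ‖∂ⱼw‖`;
* `Torus.hasZeroMean_partialDeriv` — derivatives have zero mean;
* `Torus.gradNormSq_laplacian_eq_sum` — `‖∇Δu‖₂² = ∑ₘ ‖Δ∂ₘu‖₂²`;
* `Torus.norm_partialDeriv_sq_le_of_isSmooth` — on `T³`, `‖∂ₖu(x)‖² ≤ K (‖Δu‖₂² + ‖∇Δu‖₂²)` for every
  smooth `u` (the sup-norm embedding applied to the zero-mean field `∂ₖu`, with `‖∇∂ₖu‖₂² ≤ ‖Δu‖₂²`,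
  `‖Δ∂ₖu‖₂² ≤ ‖∇Δu‖₂²`) — the `W^{1,∞}` bound by `H³` consumed by the coefficient hypotheses
  `‖∂ᵢu‖ ≤ Cᵢ` of the linearised / difference smoothing estimates;
* `Torus.gradNormSq_add_le` — `‖∇(f + g)‖₂² ≤ 2‖∇f‖₂² + 2‖∇g‖₂²`;
* `Torus.gradNormSq_convect_le_of_norm_left_le`, `Torus.gradNormSq_convect_le_of_norm_right_le` — in
  every dimension, `‖∇((v·∇)w)‖₂² ≤ 2d M₀² ‖Δw‖₂² + 2d² M₁² ‖∇w‖₂²` when `‖v‖ ≤ M₀`, `‖∂ₖv‖ ≤ M₁`, resp.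
  `‖∇((v·∇)w)‖₂² ≤ 2d M₀² ‖Δw‖₂² + 2d² M₁² ‖∇v‖₂²` when `‖v‖ ≤ M₀`, `‖∂ⱼw‖ ≤ M₁`;
* `Torus.integral_norm_laplacian_convect_self_sq_le` — **the estimate**: on `T^d` with `card d = 3`
  there is `C ≥ 0` with
  `‖Δ((u·∇)u)‖₂² ≤ C (‖∇u‖₂² + ‖Δu‖₂²) (‖Δu‖₂² + ‖∇Δu‖₂²)` for every smooth zero-mean `u`
  (`‖∇·‖₂² = Torus.gradNormSq`, `‖Δ·‖₂² = ∫ ‖Torus.laplacian ·‖²`).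

Proof of the estimate: `‖Δ B‖₂² = ∑ₘ ‖∇∂ₘB‖₂²` (`Torus.sum_gradNormSq_partialDeriv_eq`),
`∂ₘB = (u·∇)∂ₘu + (∂ₘu·∇)u`, the two `‖∇((v·∇)w)‖₂²` bounds with the sup norms `‖u‖² ≤ K(‖∇u‖₂² + ‖Δu‖₂²)`
and `‖∂ₖu‖² ≤ K'(‖Δu‖₂² + ‖∇Δu‖₂²)`; only sup-norm embeddings are used (no `L⁴` interpolation), so
the bound is linear in the top-order quantity `‖∇Δu‖₂²`, which is what the `H³` Grönwall step needs.
Consumed by the `H³` smoothing estimate of classical Navier–Stokes solutions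
(`FluidPDE/TorusClassicalNSH3Smoothing.lean`).

## Mathlib / tree search

Tree (reused): `Torus.partialDeriv_convect_self_eq_add`, `Torus.norm_sq_le_gradNormSq_add_of_hasZeroMean`,
`Torus.integral_sum_sum_norm_partialDeriv_partialDeriv_sq_eq` (`TorusConvectionGradNormSq`),
`Torus.sum_gradNormSq_partialDeriv_eq` (`TorusEnstrophyTrilinear`), `Torus.convect_eq_sum_smul_partialDeriv`,
`Torus.partialDeriv_comm`, `Torus.partialDeriv_finset_sum`, `Torus.partialDeriv_apply_coord`
(`TorusEnstrophyOrthogonality`), `Torus.partialDeriv_smul`, `Torus.integral_partialDeriv_eq_zero_holds`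
(`TorusCalculusProofs`), `Torus.partialDeriv_add` (`TorusTestFunction`), `Torus.norm_convect_le`
(`TorusFourierModes`), `Torus.partialDeriv_laplacian_comm` (`TorusInverseLaplacianCalculus`); Mathlib
`sq_sum_le_card_mul_sum_sq`, `Finset.single_le_sum`. Searched `laplacian (convect`, `laplacian_convect`,
`norm_partialDeriv_sq_le`, `hasZeroMean_partialDeriv`, `gradNormSq_add_le`: no `H²` bound of the inertial
term on the torus (the general Leibniz rule exists as `Literature.Analysis.FluidPDE.Gluing.partialDeriv_convect`
in `CheskidovGluedCalculus`, not imported into `FunctionSpaces`; re-derived here in the `… = (v·∇)∂ₘw + (∂ₘv·∇)w`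
form in ten lines).

## References

* J. C. Robinson, J. L. Rodrigo, W. Sadowski, *The Three-Dimensional Navier–Stokes Equations*,
  CUP 2016, proof of Thm 7.1 ((7.3), `H^k` is an algebra, `k ≥ 2`). [RobinsonRodrigoSadowskiCUP2016]
* P. Constantin, C. Foias, *Navier–Stokes Equations*, Univ. Chicago Press 1988, Ch. 6 and Ch. 10,
  Thm 10.6. [ConstantinFoiasNSE1988]
-/

noncomputable section

open _root_.MeasureTheory Set Filter Function
open scoped ENNReal NNReal InnerProductSpace ContDiff

namespace Literature.Analysis.FunctionSpaces

namespace Torus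

variable {d : Type*} [Fintype d] [DecidableEq d]
variable {F : Type*} [NormedAddCommGroup F] [NormedSpace ℝ F]

/-! ### Pointwise algebra -/

/-- **Leibniz rule for the convective derivative of one smooth field along another**:
`∂ₘ((v·∇)w) = (v·∇)∂ₘw + (∂ₘv·∇)w` pointwise (`(v·∇)w = ∑ᵢ vᵢ ∂ᵢw`, the product rule, and
`∂ₘ∂ᵢ = ∂ᵢ∂ₘ`). [folklore] -/
theorem partialDeriv_convect_eq_add_convect {v : UnitAddTorus d → EuclideanSpace ℝ d}
    {w : UnitAddTorus d → F} (hv : IsSmooth v) (hw : IsSmooth w) (m : d) (x : UnitAddTorus d) :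
    partialDeriv m (convect v w) x = convect v (partialDeriv m w) x + convect (partialDeriv m v) w x := by
  have hv1 : IsContDiff 1 v := hv.isContDiff (by simp)
  have hw1 : IsContDiff 1 w := hw.isContDiff (by simp)
  have hcoord : ∀ i, IsContDiff 1 (fun y => v y i) := fun i => (hv.apply i).isContDiff (by simp)
  have hD : ∀ i, IsContDiff 1 (partialDeriv i w) := fun i => (hw.partialDeriv i).isContDiff (by simp)
  have hfun : convect v w = fun y => ∑ i, v y i • partialDeriv i w y := by
    funext y; exact convect_eq_sum_smul_partialDeriv hw1 y
  have hsm : ∀ i, IsContDiff 1 (fun y => v y i • partialDeriv i w y) := fun i =>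
    ContDiff.smul (hcoord i) (hD i)
  rw [hfun, partialDeriv_finset_sum _ (fun i _ => hsm i) m x, convect_eq_sum_smul_partialDeriv (hD m) x,
    convect_eq_sum_smul_partialDeriv hw1 x, ← Finset.sum_add_distrib]
  refine Finset.sum_congr rfl fun i _ => ?_
  rw [partialDeriv_smul (hcoord i) (hD i), partialDeriv_apply_coord hv1, partialDeriv_comm hw m i x]

/-- **Size of the gradient of a convective derivative, pointwise**:
`‖∂ₖ((v·∇)w)(x)‖ ≤ ‖v(x)‖ ∑ⱼ ‖∂ⱼ∂ₖw(x)‖ + ‖∂ₖv(x)‖ ∑ⱼ ‖∂ⱼw(x)‖` (Leibniz and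
`‖(a·∇)b‖ ≤ ‖a‖ ∑ⱼ ‖∂ⱼb‖`, `Torus.norm_convect_le`). [folklore] -/
theorem norm_partialDeriv_convect_le_add {v w : UnitAddTorus d → EuclideanSpace ℝ d}
    (hv : IsSmooth v) (hw : IsSmooth w) (k : d) (x : UnitAddTorus d) :
    ‖partialDeriv k (convect v w) x‖ ≤
      ‖v x‖ * ∑ j, ‖partialDeriv j (partialDeriv k w) x‖ +
        ‖partialDeriv k v x‖ * ∑ j, ‖partialDeriv j w x‖ := by
  rw [partialDeriv_convect_eq_add_convect hv hw k x]
  refine (norm_add_le _ _).trans (add_le_add ?_ ?_)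
  · exact norm_convect_le v ((hw.partialDeriv k).isContDiff (by simp)) x
  · exact norm_convect_le (partialDeriv k v) (hw.isContDiff (by simp)) x

/-! ### Zero mean of derivatives; the `H³` seminorm as a sum -/

/-- **Derivatives of smooth functions on the torus have zero mean** (`∫ ∂ₖf = 0`,
`Torus.integral_partialDeriv_eq_zero_holds`). [folklore] -/
theorem hasZeroMean_partialDeriv {f : UnitAddTorus d → F} (hf : IsSmooth f) (k : d) :
    HasZeroMean (partialDeriv k f) :=
  integral_partialDeriv_eq_zero_holds hf k

/-- **`‖∇Δu‖₂² = ∑ₘ ‖Δ∂ₘu‖₂²`** (`∂ₘΔ = Δ∂ₘ`, `Torus.partialDeriv_laplacian_comm`, and the sum pulled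
out of the integral). [folklore] -/
theorem gradNormSq_laplacian_eq_sum {u : UnitAddTorus d → EuclideanSpace ℝ d} (hu : IsSmooth u) :
    gradNormSq (laplacian u) = ∑ m, ∫ x, ‖laplacian (partialDeriv m u) x‖ ^ 2 := by
  have hΔ : IsSmooth (laplacian u) := hu.laplacian
  rw [gradNormSq, integral_finsetSum _ fun m _ => ((hΔ.partialDeriv m).norm_sq).integrable]
  refine Finset.sum_congr rfl fun m _ => integral_congr_ae (ae_of_all _ fun x => ?_)
  dsimp only
  rw [partialDeriv_laplacian_comm hu m x]

/-- **Sup norm of the gradient by `‖Δu‖₂² + ‖∇Δu‖₂²` on `T³`**: on `T^d` with `card d = 3` there is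
`K > 0` such that `‖∂ₖu(x)‖² ≤ K (‖Δu‖₂² + ‖∇Δu‖₂²)` for every smooth `u : T^d → ℝ^d`, every `k` and
every `x` — the sup-norm embedding `Torus.norm_sq_le_gradNormSq_add_of_hasZeroMean` applied to the
zero-mean field `∂ₖu`, together with `‖∇∂ₖu‖₂² ≤ ∑ₘ ‖∇∂ₘu‖₂² = ‖Δu‖₂²` and
`‖Δ∂ₖu‖₂² ≤ ∑ₘ ‖Δ∂ₘu‖₂² = ‖∇Δu‖₂²`. No zero-mean hypothesis on `u` is needed. This is the
`W^{1,∞} ⊂ H³` bound that turns a uniform `H³` bound along a trajectory into the coefficient bounds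
`‖∂ᵢu‖ ≤ Cᵢ` of the linearised and difference estimates. [folklore] -/
theorem norm_partialDeriv_sq_le_of_isSmooth (hd : Fintype.card d = 3) :
    ∃ K : ℝ, 0 < K ∧ ∀ u : UnitAddTorus d → EuclideanSpace ℝ d, IsSmooth u → ∀ (k : d) (x : UnitAddTorus d),
      ‖partialDeriv k u x‖ ^ 2 ≤ K * ((∫ y, ‖laplacian u y‖ ^ 2) + gradNormSq (laplacian u)) := by
  obtain ⟨K, hK, hsup⟩ := norm_sq_le_gradNormSq_add_of_hasZeroMean (d := d) hd
  refine ⟨K, hK, fun u hu k x => ?_⟩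
  have hD : ∀ m, IsSmooth (partialDeriv m u) := fun m => hu.partialDeriv m
  have h := hsup (partialDeriv k u) (hD k) (hasZeroMean_partialDeriv hu k) x
  have h1 : gradNormSq (partialDeriv k u) ≤ ∫ y, ‖laplacian u y‖ ^ 2 := by
    rw [← sum_gradNormSq_partialDeriv_eq hu]
    exact Finset.single_le_sum (f := fun m => gradNormSq (partialDeriv m u))
      (fun m _ => gradNormSq_nonneg (partialDeriv m u)) (Finset.mem_univ k)
  have h2 : ∫ y, ‖laplacian (partialDeriv k u) y‖ ^ 2 ≤ gradNormSq (laplacian u) := by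
    rw [gradNormSq_laplacian_eq_sum hu]
    exact Finset.single_le_sum (f := fun m => ∫ y, ‖laplacian (partialDeriv m u) y‖ ^ 2)
      (fun m _ => integral_nonneg fun y => sq_nonneg _) (Finset.mem_univ k)
  calc ‖partialDeriv k u x‖ ^ 2
      ≤ K * (gradNormSq (partialDeriv k u) + ∫ y, ‖laplacian (partialDeriv k u) y‖ ^ 2) := h
    _ ≤ K * ((∫ y, ‖laplacian u y‖ ^ 2) + gradNormSq (laplacian u)) :=
        mul_le_mul_of_nonneg_left (add_le_add h1 h2) hK.le

/-! ### `L²` gradients of sums and of convective derivatives -/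

/-- `‖∇(f + g)‖₂² ≤ 2‖∇f‖₂² + 2‖∇g‖₂²` for smooth fields. [folklore] -/
theorem gradNormSq_add_le {f g : UnitAddTorus d → EuclideanSpace ℝ d} (hf : IsSmooth f) (hg : IsSmooth g) :
    gradNormSq (f + g) ≤ 2 * gradNormSq f + 2 * gradNormSq g := by
  have hf1 : IsContDiff 1 f := hf.isContDiff (by simp)
  have hg1 : IsContDiff 1 g := hg.isContDiff (by simp)
  have hif : Integrable (fun x => ∑ i, ‖partialDeriv i f x‖ ^ 2) volume :=
    integrable_finsetSum _ fun i _ => ((hf.partialDeriv i).norm_sq).integrable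
  have hig : Integrable (fun x => ∑ i, ‖partialDeriv i g x‖ ^ 2) volume :=
    integrable_finsetSum _ fun i _ => ((hg.partialDeriv i).norm_sq).integrable
  have hifg : Integrable (fun x => ∑ i, ‖partialDeriv i (f + g) x‖ ^ 2) volume :=
    integrable_finsetSum _ fun i _ => (((hf.add hg).partialDeriv i).norm_sq).integrable
  have hsq : ∀ p q : EuclideanSpace ℝ d, ‖p + q‖ ^ 2 ≤ 2 * ‖p‖ ^ 2 + 2 * ‖q‖ ^ 2 := fun p q => by
    have h := norm_add_le p q
    nlinarith [norm_nonneg (p + q), norm_nonneg p, norm_nonneg q, sq_nonneg (‖p‖ - ‖q‖)]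
  have hpt : ∀ x, ∑ i, ‖partialDeriv i (f + g) x‖ ^ 2 ≤
      2 * ∑ i, ‖partialDeriv i f x‖ ^ 2 + 2 * ∑ i, ‖partialDeriv i g x‖ ^ 2 := by
    intro x
    rw [Finset.mul_sum, Finset.mul_sum, ← Finset.sum_add_distrib]
    refine Finset.sum_le_sum fun i _ => ?_
    rw [partialDeriv_add hf1 hg1 i, Pi.add_apply]
    exact hsq _ _
  calc gradNormSq (f + g) = ∫ x, ∑ i, ‖partialDeriv i (f + g) x‖ ^ 2 := rfl
    _ ≤ ∫ x, (2 * ∑ i, ‖partialDeriv i f x‖ ^ 2 + 2 * ∑ i, ‖partialDeriv i g x‖ ^ 2) :=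
        integral_mono hifg ((hif.const_mul _).add (hig.const_mul _)) hpt
    _ = 2 * gradNormSq f + 2 * gradNormSq g := by
        rw [integral_add (hif.const_mul _) (hig.const_mul _), integral_const_mul, integral_const_mul]
        rfl

/-- **`‖∇((v·∇)w)‖₂² ≤ 2d M₀² ‖Δw‖₂² + 2d² M₁² ‖∇w‖₂²` when `‖v‖ ≤ M₀` and `‖∂ₖv‖ ≤ M₁`** (every
dimension; the "transport" shape, all derivatives falling on `w` are square integrable):
pointwise `‖∂ₖ((v·∇)w)‖ ≤ M₀ ∑ⱼ‖∂ⱼ∂ₖw‖ + M₁ ∑ⱼ‖∂ⱼw‖`, `(a + b)² ≤ 2a² + 2b²`, Cauchy–Schwarz in `j`,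
and `∫ ∑ₖ∑ⱼ ‖∂ⱼ∂ₖw‖² = ‖Δw‖₂²`. [folklore] -/
theorem gradNormSq_convect_le_of_norm_left_le {v w : UnitAddTorus d → EuclideanSpace ℝ d}
    (hv : IsSmooth v) (hw : IsSmooth w) {M₀ M₁ : ℝ} (h0 : ∀ x, ‖v x‖ ≤ M₀)
    (h1 : ∀ (k : d) (x : UnitAddTorus d), ‖partialDeriv k v x‖ ≤ M₁) :
    gradNormSq (convect v w) ≤ 2 * Fintype.card d * M₀ ^ 2 * (∫ x, ‖laplacian w x‖ ^ 2) +
      2 * Fintype.card d ^ 2 * M₁ ^ 2 * gradNormSq w := by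
  have hB : IsSmooth (convect v w) := hv.convect hw
  have hDD : ∀ j k, IsSmooth (partialDeriv j (partialDeriv k w)) := fun j k =>
    (hw.partialDeriv k).partialDeriv j
  have hHi : Integrable (fun x => ∑ k, ∑ j, ‖partialDeriv j (partialDeriv k w) x‖ ^ 2) volume :=
    integrable_finsetSum _ fun k _ => integrable_finsetSum _ fun j _ => ((hDD j k).norm_sq).integrable
  have hθi : Integrable (fun x => ∑ j, ‖partialDeriv j w x‖ ^ 2) volume :=
    integrable_finsetSum _ fun j _ => ((hw.partialDeriv j).norm_sq).integrable
  have hdens : Integrable (fun x => ∑ k, ‖partialDeriv k (convect v w) x‖ ^ 2) volume :=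
    integrable_finsetSum _ fun k _ => ((hB.partialDeriv k).norm_sq).integrable
  -- pointwise bound of the density
  have hpt : ∀ x, ∑ k, ‖partialDeriv k (convect v w) x‖ ^ 2 ≤
      2 * Fintype.card d * M₀ ^ 2 * (∑ k, ∑ j, ‖partialDeriv j (partialDeriv k w) x‖ ^ 2) +
        2 * Fintype.card d ^ 2 * M₁ ^ 2 * ∑ j, ‖partialDeriv j w x‖ ^ 2 := by
    intro x
    have hterm : ∀ k, ‖partialDeriv k (convect v w) x‖ ^ 2 ≤
        2 * Fintype.card d * M₀ ^ 2 * (∑ j, ‖partialDeriv j (partialDeriv k w) x‖ ^ 2) +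
          2 * Fintype.card d * M₁ ^ 2 * ∑ j, ‖partialDeriv j w x‖ ^ 2 := by
      intro k
      set S₂ : ℝ := ∑ j, ‖partialDeriv j (partialDeriv k w) x‖ with hS₂
      set S₁ : ℝ := ∑ j, ‖partialDeriv j w x‖ with hS₁
      have hS₂0 : 0 ≤ S₂ := Finset.sum_nonneg fun j _ => norm_nonneg _
      have hS₁0 : 0 ≤ S₁ := Finset.sum_nonneg fun j _ => norm_nonneg _
      have hS₂2 : S₂ ^ 2 ≤ Fintype.card d * ∑ j, ‖partialDeriv j (partialDeriv k w) x‖ ^ 2 := by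
        have h := sq_sum_le_card_mul_sum_sq (s := Finset.univ)
          (f := fun j => ‖partialDeriv j (partialDeriv k w) x‖)
        rwa [Finset.card_univ] at h
      have hS₁2 : S₁ ^ 2 ≤ Fintype.card d * ∑ j, ‖partialDeriv j w x‖ ^ 2 := by
        have h := sq_sum_le_card_mul_sum_sq (s := Finset.univ) (f := fun j => ‖partialDeriv j w x‖)
        rwa [Finset.card_univ] at h
      have hle : ‖partialDeriv k (convect v w) x‖ ≤ M₀ * S₂ + M₁ * S₁ :=
        (norm_partialDeriv_convect_le_add hv hw k x).trans
          (add_le_add (mul_le_mul_of_nonneg_right (h0 x) hS₂0) (mul_le_mul_of_nonneg_right (h1 k x) hS₁0))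
      have hM0 : 0 ≤ M₀ := (norm_nonneg _).trans (h0 x)
      have hM1 : 0 ≤ M₁ := (norm_nonneg _).trans (h1 k x)
      have hsq : ‖partialDeriv k (convect v w) x‖ ^ 2 ≤ (M₀ * S₂ + M₁ * S₁) ^ 2 :=
        pow_le_pow_left₀ (norm_nonneg _) hle 2
      have h2 : (M₀ * S₂ + M₁ * S₁) ^ 2 ≤ 2 * (M₀ ^ 2 * S₂ ^ 2) + 2 * (M₁ ^ 2 * S₁ ^ 2) := by
        nlinarith [sq_nonneg (M₀ * S₂ - M₁ * S₁)]
      calc ‖partialDeriv k (convect v w) x‖ ^ 2 ≤ (M₀ * S₂ + M₁ * S₁) ^ 2 := hsq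
        _ ≤ 2 * (M₀ ^ 2 * S₂ ^ 2) + 2 * (M₁ ^ 2 * S₁ ^ 2) := h2
        _ ≤ 2 * (M₀ ^ 2 * (Fintype.card d * ∑ j, ‖partialDeriv j (partialDeriv k w) x‖ ^ 2)) +
              2 * (M₁ ^ 2 * (Fintype.card d * ∑ j, ‖partialDeriv j w x‖ ^ 2)) := by gcongr
        _ = _ := by ring
    calc ∑ k, ‖partialDeriv k (convect v w) x‖ ^ 2
        ≤ ∑ k, (2 * Fintype.card d * M₀ ^ 2 * (∑ j, ‖partialDeriv j (partialDeriv k w) x‖ ^ 2) +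
            2 * Fintype.card d * M₁ ^ 2 * ∑ j, ‖partialDeriv j w x‖ ^ 2) :=
          Finset.sum_le_sum fun k _ => hterm k
      _ = _ := by
          rw [Finset.sum_add_distrib, ← Finset.mul_sum, Finset.sum_const, Finset.card_univ, nsmul_eq_mul]
          ring
  calc gradNormSq (convect v w) = ∫ x, ∑ k, ‖partialDeriv k (convect v w) x‖ ^ 2 := rfl
    _ ≤ ∫ x, (2 * Fintype.card d * M₀ ^ 2 * (∑ k, ∑ j, ‖partialDeriv j (partialDeriv k w) x‖ ^ 2) +
          2 * Fintype.card d ^ 2 * M₁ ^ 2 * ∑ j, ‖partialDeriv j w x‖ ^ 2) :=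
        integral_mono hdens ((hHi.const_mul _).add (hθi.const_mul _)) hpt
    _ = 2 * Fintype.card d * M₀ ^ 2 * (∫ x, ∑ k, ∑ j, ‖partialDeriv j (partialDeriv k w) x‖ ^ 2) +
          2 * Fintype.card d ^ 2 * M₁ ^ 2 * ∫ x, ∑ j, ‖partialDeriv j w x‖ ^ 2 := by
        rw [integral_add (hHi.const_mul _) (hθi.const_mul _), integral_const_mul, integral_const_mul]
    _ = _ := by rw [integral_sum_sum_norm_partialDeriv_partialDeriv_sq_eq hw]; rfl

/-- **`‖∇((v·∇)w)‖₂² ≤ 2d M₀² ‖Δw‖₂² + 2d² M₁² ‖∇v‖₂²` when `‖v‖ ≤ M₀` and `‖∂ⱼw‖ ≤ M₁`** (every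
dimension; the "stretching" shape, the first derivatives of `w` are bounded instead of those of `v`):
pointwise `‖∂ₖ((v·∇)w)‖ ≤ M₀ ∑ⱼ‖∂ⱼ∂ₖw‖ + d M₁ ‖∂ₖv‖`. [folklore] -/
theorem gradNormSq_convect_le_of_norm_right_le {v w : UnitAddTorus d → EuclideanSpace ℝ d}
    (hv : IsSmooth v) (hw : IsSmooth w) {M₀ M₁ : ℝ} (h0 : ∀ x, ‖v x‖ ≤ M₀)
    (h1 : ∀ (j : d) (x : UnitAddTorus d), ‖partialDeriv j w x‖ ≤ M₁) :
    gradNormSq (convect v w) ≤ 2 * Fintype.card d * M₀ ^ 2 * (∫ x, ‖laplacian w x‖ ^ 2) +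
      2 * Fintype.card d ^ 2 * M₁ ^ 2 * gradNormSq v := by
  have hB : IsSmooth (convect v w) := hv.convect hw
  have hDD : ∀ j k, IsSmooth (partialDeriv j (partialDeriv k w)) := fun j k =>
    (hw.partialDeriv k).partialDeriv j
  have hHi : Integrable (fun x => ∑ k, ∑ j, ‖partialDeriv j (partialDeriv k w) x‖ ^ 2) volume :=
    integrable_finsetSum _ fun k _ => integrable_finsetSum _ fun j _ => ((hDD j k).norm_sq).integrable
  have hθi : Integrable (fun x => ∑ k, ‖partialDeriv k v x‖ ^ 2) volume :=
    integrable_finsetSum _ fun k _ => ((hv.partialDeriv k).norm_sq).integrable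
  have hdens : Integrable (fun x => ∑ k, ‖partialDeriv k (convect v w) x‖ ^ 2) volume :=
    integrable_finsetSum _ fun k _ => ((hB.partialDeriv k).norm_sq).integrable
  have hpt : ∀ x, ∑ k, ‖partialDeriv k (convect v w) x‖ ^ 2 ≤
      2 * Fintype.card d * M₀ ^ 2 * (∑ k, ∑ j, ‖partialDeriv j (partialDeriv k w) x‖ ^ 2) +
        2 * Fintype.card d ^ 2 * M₁ ^ 2 * ∑ k, ‖partialDeriv k v x‖ ^ 2 := by
    intro x
    have hterm : ∀ k, ‖partialDeriv k (convect v w) x‖ ^ 2 ≤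
        2 * Fintype.card d * M₀ ^ 2 * (∑ j, ‖partialDeriv j (partialDeriv k w) x‖ ^ 2) +
          2 * Fintype.card d ^ 2 * M₁ ^ 2 * ‖partialDeriv k v x‖ ^ 2 := by
      intro k
      set S₂ : ℝ := ∑ j, ‖partialDeriv j (partialDeriv k w) x‖ with hS₂
      have hS₂0 : 0 ≤ S₂ := Finset.sum_nonneg fun j _ => norm_nonneg _
      have hS₂2 : S₂ ^ 2 ≤ Fintype.card d * ∑ j, ‖partialDeriv j (partialDeriv k w) x‖ ^ 2 := by
        have h := sq_sum_le_card_mul_sum_sq (s := Finset.univ)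
          (f := fun j => ‖partialDeriv j (partialDeriv k w) x‖)
        rwa [Finset.card_univ] at h
      have hS₁ : ∑ j, ‖partialDeriv j w x‖ ≤ Fintype.card d * M₁ := by
        calc ∑ j, ‖partialDeriv j w x‖ ≤ ∑ _j : d, M₁ := Finset.sum_le_sum fun j _ => h1 j x
          _ = Fintype.card d * M₁ := by rw [Finset.sum_const, Finset.card_univ, nsmul_eq_mul]
      have hM0 : 0 ≤ M₀ := (norm_nonneg _).trans (h0 x)
      have hle : ‖partialDeriv k (convect v w) x‖ ≤ M₀ * S₂ + ‖partialDeriv k v x‖ * (Fintype.card d * M₁) :=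
        (norm_partialDeriv_convect_le_add hv hw k x).trans
          (add_le_add (mul_le_mul_of_nonneg_right (h0 x) hS₂0) (mul_le_mul_of_nonneg_left hS₁ (norm_nonneg _)))
      have hsq : ‖partialDeriv k (convect v w) x‖ ^ 2 ≤ (M₀ * S₂ + ‖partialDeriv k v x‖ * (Fintype.card d * M₁)) ^ 2 :=
        pow_le_pow_left₀ (norm_nonneg _) hle 2
      have h2 : (M₀ * S₂ + ‖partialDeriv k v x‖ * (Fintype.card d * M₁)) ^ 2 ≤
          2 * (M₀ ^ 2 * S₂ ^ 2) + 2 * Fintype.card d ^ 2 * M₁ ^ 2 * ‖partialDeriv k v x‖ ^ 2 := by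
        nlinarith [sq_nonneg (M₀ * S₂ - ‖partialDeriv k v x‖ * (Fintype.card d * M₁))]
      calc ‖partialDeriv k (convect v w) x‖ ^ 2
          ≤ (M₀ * S₂ + ‖partialDeriv k v x‖ * (Fintype.card d * M₁)) ^ 2 := hsq
        _ ≤ 2 * (M₀ ^ 2 * S₂ ^ 2) + 2 * Fintype.card d ^ 2 * M₁ ^ 2 * ‖partialDeriv k v x‖ ^ 2 := h2
        _ ≤ 2 * (M₀ ^ 2 * (Fintype.card d * ∑ j, ‖partialDeriv j (partialDeriv k w) x‖ ^ 2)) +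
              2 * Fintype.card d ^ 2 * M₁ ^ 2 * ‖partialDeriv k v x‖ ^ 2 := by gcongr
        _ = _ := by ring
    calc ∑ k, ‖partialDeriv k (convect v w) x‖ ^ 2
        ≤ ∑ k, (2 * Fintype.card d * M₀ ^ 2 * (∑ j, ‖partialDeriv j (partialDeriv k w) x‖ ^ 2) +
            2 * Fintype.card d ^ 2 * M₁ ^ 2 * ‖partialDeriv k v x‖ ^ 2) :=
          Finset.sum_le_sum fun k _ => hterm k
      _ = _ := by rw [Finset.sum_add_distrib, ← Finset.mul_sum, ← Finset.mul_sum]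
  calc gradNormSq (convect v w) = ∫ x, ∑ k, ‖partialDeriv k (convect v w) x‖ ^ 2 := rfl
    _ ≤ ∫ x, (2 * Fintype.card d * M₀ ^ 2 * (∑ k, ∑ j, ‖partialDeriv j (partialDeriv k w) x‖ ^ 2) +
          2 * Fintype.card d ^ 2 * M₁ ^ 2 * ∑ k, ‖partialDeriv k v x‖ ^ 2) :=
        integral_mono hdens ((hHi.const_mul _).add (hθi.const_mul _)) hpt
    _ = 2 * Fintype.card d * M₀ ^ 2 * (∫ x, ∑ k, ∑ j, ‖partialDeriv j (partialDeriv k w) x‖ ^ 2) +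
          2 * Fintype.card d ^ 2 * M₁ ^ 2 * ∫ x, ∑ k, ‖partialDeriv k v x‖ ^ 2 := by
        rw [integral_add (hHi.const_mul _) (hθi.const_mul _), integral_const_mul, integral_const_mul]
    _ = _ := by rw [integral_sum_sum_norm_partialDeriv_partialDeriv_sq_eq hw]; rfl

/-! ### The estimate -/

/-- **`‖Δ((u·∇)u)‖₂² ≤ C (‖∇u‖₂² + ‖Δu‖₂²) (‖Δu‖₂² + ‖∇Δu‖₂²)` on `T³`** (the bilinear term maps
`D(A^{3/2}) × D(A^{3/2})` into `D(A)` for zero-mean space-periodic fields — the `H²`-level instance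
of "`H^k(T³)` is an algebra", Robinson–Rodrigo–Sadowski 2016, proof of Thm 7.1, (7.3) with `k = 3`;
Constantin–Foias 1988, Ch. 6): on `T^d` with `card d = 3` there is `C ≥ 0` such that for every smooth
zero-mean `u : T^d → ℝ^d`,
`∫ ‖Δ((u·∇)u)‖² ≤ C (gradNormSq u + ∫ ‖Δu‖²) (∫ ‖Δu‖² + gradNormSq (Δu))`.
Proof: `∫ ‖ΔB‖² = ∑ₘ ‖∇∂ₘB‖₂²`, `∂ₘB = (u·∇)∂ₘu + (∂ₘu·∇)u`,
`gradNormSq_convect_le_of_norm_left_le` / `…_right_le` with the sup bounds `‖u‖² ≤ K (E + Y)`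
(`Torus.norm_sq_le_gradNormSq_add_of_hasZeroMean`) and `‖∂ₖu‖² ≤ K' (Y + Z)`
(`norm_partialDeriv_sq_le_of_isSmooth`), then `∑ₘ ‖Δ∂ₘu‖₂² = Z`, `∑ₘ ‖∇∂ₘu‖₂² = Y`;
`C = 4dK + 12d²K'`. [cite: RobinsonRodrigoSadowskiCUP2016, proof of Thm 7.1 (7.3)] -/
theorem integral_norm_laplacian_convect_self_sq_le (hd : Fintype.card d = 3) :
    ∃ C : ℝ, 0 ≤ C ∧ ∀ u : UnitAddTorus d → EuclideanSpace ℝ d, IsSmooth u → HasZeroMean u →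
      ∫ x, ‖laplacian (convect u u) x‖ ^ 2 ≤
        C * (gradNormSq u + ∫ x, ‖laplacian u x‖ ^ 2) *
          ((∫ x, ‖laplacian u x‖ ^ 2) + gradNormSq (laplacian u)) := by
  obtain ⟨K, hK, hsup⟩ := norm_sq_le_gradNormSq_add_of_hasZeroMean (d := d) hd
  obtain ⟨K', hK', hsup'⟩ := norm_partialDeriv_sq_le_of_isSmooth (d := d) hd
  refine ⟨4 * Fintype.card d * K + 12 * Fintype.card d ^ 2 * K', by positivity, fun u hu h0 => ?_⟩
  set E : ℝ := gradNormSq u with hE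
  set Y : ℝ := ∫ x, ‖laplacian u x‖ ^ 2 with hY
  set Z : ℝ := gradNormSq (laplacian u) with hZ
  have hE0 : 0 ≤ E := gradNormSq_nonneg u
  have hY0 : 0 ≤ Y := integral_nonneg fun x => sq_nonneg _
  have hZ0 : 0 ≤ Z := gradNormSq_nonneg _
  have hB : IsSmooth (convect u u) := hu.convect hu
  have hD : ∀ m, IsSmooth (partialDeriv m u) := fun m => hu.partialDeriv m
  -- the sup bounds `‖u‖ ≤ N₀`, `‖∂ₖu‖ ≤ N₁`
  set N₀ : ℝ := Real.sqrt (K * (E + Y)) with hN₀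
  have hN₀2 : N₀ ^ 2 = K * (E + Y) := Real.sq_sqrt (by positivity)
  have hN₀x : ∀ x, ‖u x‖ ≤ N₀ := fun x => by
    rw [hN₀, ← Real.sqrt_sq (norm_nonneg (u x))]
    exact Real.sqrt_le_sqrt (hsup u hu h0 x)
  set N₁ : ℝ := Real.sqrt (K' * (Y + Z)) with hN₁
  have hN₁2 : N₁ ^ 2 = K' * (Y + Z) := Real.sq_sqrt (by positivity)
  have hN₁x : ∀ (k : d) (x : UnitAddTorus d), ‖partialDeriv k u x‖ ≤ N₁ := fun k x => by
    rw [hN₁, ← Real.sqrt_sq (norm_nonneg (partialDeriv k u x))]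
    exact Real.sqrt_le_sqrt (hsup' u hu k x)
  -- each `m`: `‖∇∂ₘB‖₂² ≤ 4dN₀² ‖Δ∂ₘu‖₂² + 8d²N₁² ‖∇∂ₘu‖₂² + 4dN₁² Y`
  have hterm : ∀ m, gradNormSq (partialDeriv m (convect u u)) ≤
      4 * Fintype.card d * N₀ ^ 2 * (∫ x, ‖laplacian (partialDeriv m u) x‖ ^ 2) +
        8 * Fintype.card d ^ 2 * N₁ ^ 2 * gradNormSq (partialDeriv m u) +
          4 * Fintype.card d * N₁ ^ 2 * Y := by
    intro m
    have hfun : partialDeriv m (convect u u) = convect u (partialDeriv m u) + convect (partialDeriv m u) u := by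
      funext x
      rw [Pi.add_apply]
      exact partialDeriv_convect_self_eq_add hu m x
    rw [hfun]
    have h1 := gradNormSq_convect_le_of_norm_left_le hu (hD m) hN₀x hN₁x
    have h2 := gradNormSq_convect_le_of_norm_right_le (hD m) hu (hN₁x m) hN₁x
    have h3 := gradNormSq_add_le (hu.convect (hD m)) ((hD m).convect hu)
    have h4 : (0 : ℝ) ≤ 2 * Fintype.card d * N₁ ^ 2 * Y := by positivity
    linarith
  have hsumZ : ∑ m, ∫ x, ‖laplacian (partialDeriv m u) x‖ ^ 2 = Z := (gradNormSq_laplacian_eq_sum hu).symm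
  have hsumY : ∑ m, gradNormSq (partialDeriv m u) = Y := sum_gradNormSq_partialDeriv_eq hu
  have hsum : ∑ m, gradNormSq (partialDeriv m (convect u u)) ≤
      4 * Fintype.card d * N₀ ^ 2 * Z + 12 * Fintype.card d ^ 2 * N₁ ^ 2 * Y := by
    calc ∑ m, gradNormSq (partialDeriv m (convect u u))
        ≤ ∑ m, (4 * Fintype.card d * N₀ ^ 2 * (∫ x, ‖laplacian (partialDeriv m u) x‖ ^ 2) +
            8 * Fintype.card d ^ 2 * N₁ ^ 2 * gradNormSq (partialDeriv m u) +
              4 * Fintype.card d * N₁ ^ 2 * Y) := Finset.sum_le_sum fun m _ => hterm m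
      _ = 4 * Fintype.card d * N₀ ^ 2 * Z + 8 * Fintype.card d ^ 2 * N₁ ^ 2 * Y +
            Fintype.card d * (4 * Fintype.card d * N₁ ^ 2 * Y) := by
          rw [Finset.sum_add_distrib, Finset.sum_add_distrib, ← Finset.mul_sum, ← Finset.mul_sum, hsumZ,
            hsumY, Finset.sum_const, Finset.card_univ, nsmul_eq_mul]
      _ = _ := by ring
  rw [← sum_gradNormSq_partialDeriv_eq hB]
  refine hsum.trans ?_
  rw [hN₀2, hN₁2]
  have hd0 : (0 : ℝ) ≤ Fintype.card d := Nat.cast_nonneg _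
  have h5 : K * (E + Y) * Z ≤ K * (E + Y) * (Y + Z) :=
    mul_le_mul_of_nonneg_left (by linarith) (by positivity)
  have h6 : K' * (Y + Z) * Y ≤ K' * (E + Y) * (Y + Z) := by
    have : (Y + Z) * Y ≤ (E + Y) * (Y + Z) := by nlinarith
    calc K' * (Y + Z) * Y = K' * ((Y + Z) * Y) := by ring
      _ ≤ K' * ((E + Y) * (Y + Z)) := mul_le_mul_of_nonneg_left this hK'.le
      _ = K' * (E + Y) * (Y + Z) := by ring
  calc 4 * Fintype.card d * (K * (E + Y)) * Z + 12 * Fintype.card d ^ 2 * (K' * (Y + Z)) * Y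
      = 4 * Fintype.card d * (K * (E + Y) * Z) + 12 * Fintype.card d ^ 2 * (K' * (Y + Z) * Y) := by ring
    _ ≤ 4 * Fintype.card d * (K * (E + Y) * (Y + Z)) + 12 * Fintype.card d ^ 2 * (K' * (E + Y) * (Y + Z)) := by
        gcongr
    _ = (4 * Fintype.card d * K + 12 * Fintype.card d ^ 2 * K') * (E + Y) * (Y + Z) := by ring

end Torus

end Literature.Analysis.FunctionSpaces

end
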